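import Literature.Probability.RandomPlanarGeometry.ConformalRestrictionFiveLeaves
import HarnessLib

/-!
# [LSW] p. 5 result 2 (`eq_five_eighths_of_outer_simple`): the comparison leaf of Cor. 8.6 reduced to the positivity of `P⁺_β{i ∈ K}` for small `β`

Proof-only sibling (no definition, no named fact) of `RestrictionMeasuresFiveEighthsAssembly`
for the named fact
`Literature.Probability.RandomPlanarGeometry.IsRestrictionMeasure.eq_five_eighths_of_outer_simple`
(`RestrictionMeasures`), after

* G. F. Lawler, O. Schramm, W. Werner, *Conformal restriction: the chordal case*, J. Amer. Math.
  Soc. **16** (2003) 917–955, arXiv:math/0209343 (**[LSW]**; arXiv page numbers), the proof of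
  Cor. 8.6 (p. 38): "Note that when `ρ < 0`, `W_t − √κ B_t` is decreasing. It follows easily
  that the probability that `i` ends up eventually to 'the right' of the right hand boundary
  of SLE(8/3, ρ) […] is strictly larger than the corresponding quantity for SLE(8/3, 0), which
  is `1/2` by symmetry", and §8.2, the sentence preceding Prop. 8.2: "Taking unions of
  independent hulls which satisfy the right-sided restriction property, yields a realization
  of another right-sided restriction measure (and the exponent add up)".

State of the tree. Of the ten printed leaves of
`IsRestrictionMeasure.eq_five_eighths_of_outer_simple_of_ten_leaves`
(`RestrictionMeasuresFiveEighthsAssembly`) five are now theorems — [LSW] Lemma 6.2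
(`Loewner.restrictionDeriv_exitTime_gt_holds`), Lemma 6.3
(`IsSmoothHull.restrictionDerivVanishesAtHit_holds`), Lemma 8.3 (2) on the positive axis
(`SLEKappaRho.swallowingTime_ofReal_pos_holds`), the symmetry sentence of p. 38
(`measure_I_notMem_leftFilling_sle_eq_half_holds`, through the Rohde–Schramm trace theorem
`hasSLETrace_of_ne_eight_holds`) and Kingman's existence theorem
(`Literature.Probability.Process.exists_isPoissonCloud_holds`) — and the fact is assembled from
the five open ones in `IsRestrictionMeasure.eq_five_eighths_of_outer_simple_of_five_leaves`
(`ConformalRestrictionFiveLeaves`): the one-sided restriction martingale of Lemmas 8.9–8.10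
(`SLEKappaRho.exists_isOneSidedMartingale`), the comparison sentence of p. 38
(`SLEKappaRho.measure_I_notMem_fill_lt_of_neg`), a Brownian bubble measure with interior points
(`exists_isBrownianBubbleMeasure_ae_interior_nonempty`, §7.1), `Ξ(κ) ∈ Ω` a.s.
(`SLEBubbles.ae_mem_restrictionConfigs`) and Thm. 6.5 (`SLEBubbles.lintegral_poissonAvoidance_eq_rpow`).

This file reduces the comparison sentence — the only one of the five for which no proof is printed
("It follows easily"; the pathwise inclusion of the two events under the monotone coupling
`W ≤ √κ B` fails for general driving functions) — to a positivity statement about the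
one-sided measures alone, GIVEN the martingale leaf (i.e. given Thm. 8.4,
`SLEKappaRho.isRightRestrictionMeasure_fill_of_martingale`):

* `IsRightRestrictionMeasure.measure_notMem_le_mul` — in the realization
  `P⁺_{α+β} = F(P⁺_α ⊗ P⁺_β)` of §8.2 (`IsRightRestrictionMeasure.fillUnion`, proved in
  `SLEKappaRhoAsymmetry`), `{z ∉ F(K₁ ∪ K₂)} ⊆ {z ∉ K₁} × {z ∉ K₂}`, so
  `P⁺_{α+β}{z ∉ K} ≤ P⁺_α{z ∉ K} · P⁺_β{z ∉ K}`; in particular (`…measure_notMem_lt_one_mono`)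
  `β ↦ P⁺_β{z ∉ K}` is non-increasing and "`P⁺_β` charges `z`" (`P⁺_β{z ∉ K} < 1`) propagates
  from `β` to every `β' ≥ β` for which `P⁺_{β'−β}` exists;
* `SLEKappaRho.measure_I_notMem_fill_lt_of_neg_of_martingale_of_pos` — **the comparison
  sentence from the martingale leaf and the positivity of `P⁺_β{i ∈ K}` for arbitrarily small
  `β > 0`**: for `−2 < ρ < 0`, `α = α(ρ) < 5/8`, `β' = 5/8 − α`, pick `0 < β ≤ β'` with
  `P⁺_β{i ∉ K} < 1`; then `P⁺_{β'}{i ∉ K} < 1` and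
  `1/2 = P⁺_{5/8}{i ∉ K} ≤ P⁺_α{i ∉ K} · P⁺_{β'}{i ∉ K} < P⁺_α{i ∉ K} = P{i ∉ F^{ℝ₊}_ℍ(cl K_∞(W))}`,
  while the SLE(8/3, 0) probability is `1/2` (`SLEKappaRho.measure_I_notMem_fill_eq_half_holds`).
  So the symmetry value `1/2` enters only through the proved sentence, and what is left of
  "It follows easily" is exactly: **for every `ε > 0` some `P⁺_β`, `0 < β ≤ ε`, gives the
  event `{i ∈ K}` positive probability** (equivalently, by the monotonicity, every `P⁺_β`,
  `β > 0`, does);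
* `SLEKappaRho.measure_I_notMem_fill_lt_of_neg_of_martingale_of_sle_pos` — the same with the
  positivity read on SLE(8/3, ρ) through Thm. 8.4: it suffices that for `ρ > −2` arbitrarily
  close to `−2`, `P{i ∈ F^{ℝ₊}_ℍ(cl K_∞(W))} ≠ 0` for SLE(8/3, ρ) (`α(ρ) ≤ (5/16)(ρ + 2) → 0`);
* `not_exists_isRestrictionMeasure_of_lt_five_eighths_of_martingale_of_pos` — hence Cor. 8.6
  from the martingale leaf and the small-`β` positivity;
* `IsRestrictionMeasure.eq_five_eighths_of_outer_simple_of_four_leaves_of_pos`,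
  `LawlerSchrammWerner2003_of_four_leaves_of_pos` — hence the named fact, and [LSW] p. 5
  result 2 itself (`LawlerSchrammWerner2003`, through `LawlerSchrammWerner2003_of_five_eighths`),
  from the martingale leaf, the small-`β` positivity, and the three §7 leaves.

Why positivity for SMALL `β` is the crux (recorded for the eventual discharge): by the
monotonicity it propagates only upwards in `β`; for `β ≥ 5/8` it thus follows from the value
`1/2` at `β = 5/8` (the symmetry sentence), but below `5/8` the only realizations of `P⁺_β` in
[LSW] are the reflected Brownian excursions of §8.2 and SLE(8/3, ρ(β)), `ρ(β) ∈ (−2, 0)`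
(Thm. 8.4), and the avoidance formula alone does not decide it (a finite Boolean combination of
avoidance events `{K ∩ A_j = ∅}`, `A_j ∈ 𝒬₊`, never forces `i ∈ K`). No new named fact is
introduced (D-0026).

Mathlib: `MeasureTheory.Measure.prod_prod`, `MeasureTheory.Measure.map_apply`,
`ENNReal.mul_lt_mul_left`. Tree: `IsRightRestrictionMeasure.fillUnion`, `.unique`,
`RightConfig.measurable_fillUnion`, `RightConfig.subset_fillUnion_left/right`,
`RightConfig.measurableSet_notMem`, `SLEKappaRho.map_apply_setOf_I_notMem`,
`SLEKappaRho.isRightRestrictionMeasure_fill_of_martingale`,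
`exists_isRightRestrictionMeasure_of_martingale`, `SLEKappaRho.measure_I_notMem_fill_eq_half_holds`,
`IsRestrictionMeasure.eq_five_eighths_of_outer_simple_of_five_leaves`,
`LawlerSchrammWerner2003_of_five_eighths`.
-/

noncomputable section

open Set MeasureTheory
open UpperHalfPlane (upperHalfPlaneSet)
open scoped NNReal ENNReal
open Literature.Probability.Process (preWienerMeasure)

namespace Literature.Probability.RandomPlanarGeometry

/-! ### Monotonicity of `β ↦ P⁺_β{z ∉ K}` (§8.2: the exponents add up) -/

/-- **`P⁺_{α+β}{z ∉ K} ≤ P⁺_α{z ∉ K} · P⁺_β{z ∉ K}`**: in the realization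
`P⁺_{α+β} = F(P⁺_α ⊗ P⁺_β)` ([LSW] §8.2; `IsRightRestrictionMeasure.fillUnion` and the
uniqueness of `P⁺_{α+β}`), `K₁ ∪ K₂ ⊆ F(K₁ ∪ K₂)`, so `{z ∉ F(K₁ ∪ K₂)} ⊆ {z ∉ K₁} ×ˢ {z ∉ K₂}`.
[cite: LawlerSchrammWerner2003Restriction, §8.2 (sentence preceding Prop. 8.2)] -/
theorem IsRightRestrictionMeasure.measure_notMem_le_mul {α β : ℝ} {Q₁ Q₂ Q : Measure RightConfig}
    (h₁ : IsRightRestrictionMeasure α Q₁) (h₂ : IsRightRestrictionMeasure β Q₂)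
    (h : IsRightRestrictionMeasure (α + β) Q) {z : ℂ} (hz : z ∈ upperHalfPlaneSet) :
    Q {K : RightConfig | z ∉ (K : Set ℂ)} ≤
      Q₁ {K : RightConfig | z ∉ (K : Set ℂ)} * Q₂ {K : RightConfig | z ∉ (K : Set ℂ)} := by
  haveI := h₁.1
  haveI := h₂.1
  rw [h.unique (h₁.fillUnion h₂),
    Measure.map_apply RightConfig.measurable_fillUnion (RightConfig.measurableSet_notMem hz)]
  calc (Q₁.prod Q₂) ((fun p : RightConfig × RightConfig ↦ RightConfig.fillUnion p.1 p.2) ⁻¹'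
          {K : RightConfig | z ∉ (K : Set ℂ)})
      ≤ (Q₁.prod Q₂) ({K : RightConfig | z ∉ (K : Set ℂ)} ×ˢ {K : RightConfig | z ∉ (K : Set ℂ)}) := by
        refine measure_mono ?_
        rintro ⟨K₁, K₂⟩ hp
        exact ⟨fun hzK ↦ hp (RightConfig.subset_fillUnion_left K₁ K₂ hzK),
          fun hzK ↦ hp (RightConfig.subset_fillUnion_right K₁ K₂ hzK)⟩
    _ = Q₁ {K : RightConfig | z ∉ (K : Set ℂ)} * Q₂ {K : RightConfig | z ∉ (K : Set ℂ)} :=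
        Measure.prod_prod _ _

/-- **"`P⁺_β` charges `z`" propagates upwards in the exponent**: if `P⁺_β{z ∉ K} < 1` and
`P⁺_{β'−β}` exists (`β ≤ β'`; for `β = β'` by uniqueness), then `P⁺_{β'}{z ∉ K} < 1`, since
`P⁺_{β'}{z ∉ K} ≤ P⁺_β{z ∉ K} · P⁺_{β'−β}{z ∉ K} ≤ P⁺_β{z ∉ K}`.
[cite: LawlerSchrammWerner2003Restriction, §8.2 (sentence preceding Prop. 8.2) with §8.1 (uniqueness of P⁺_α)] -/
theorem IsRightRestrictionMeasure.measure_notMem_lt_one_mono {β β' : ℝ} {Qβ Qβ' : Measure RightConfig}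
    (hQβ : IsRightRestrictionMeasure β Qβ) (hQβ' : IsRightRestrictionMeasure β' Qβ')
    (hββ' : β ≤ β')
    (hex : β < β' → ∃ Q : Measure RightConfig, IsRightRestrictionMeasure (β' - β) Q)
    {z : ℂ} (hz : z ∈ upperHalfPlaneSet)
    (hlt : Qβ {K : RightConfig | z ∉ (K : Set ℂ)} < 1) :
    Qβ' {K : RightConfig | z ∉ (K : Set ℂ)} < 1 := by
  rcases hββ'.eq_or_lt with heq | hlt'
  · subst heq
    rwa [hQβ'.unique hQβ]
  · obtain ⟨Qγ, hQγ⟩ := hex hlt'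
    haveI := hQγ.1
    have hsum : IsRightRestrictionMeasure (β + (β' - β)) Qβ' := by
      rwa [add_sub_cancel]
    calc Qβ' {K : RightConfig | z ∉ (K : Set ℂ)}
        ≤ Qβ {K : RightConfig | z ∉ (K : Set ℂ)} * Qγ {K : RightConfig | z ∉ (K : Set ℂ)} :=
          hQβ.measure_notMem_le_mul hQγ hsum hz
      _ ≤ Qβ {K : RightConfig | z ∉ (K : Set ℂ)} * 1 := by
          gcongr
          exact prob_le_one
      _ < 1 := by rwa [mul_one]

/-! ### The comparison sentence of p. 38 from the martingale leaf and the small-`β` positivity -/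

/-- `i ∈ ℍ`. [folklore] -/
private theorem I_mem_upperHalfPlaneSet : (Complex.I : ℂ) ∈ upperHalfPlaneSet := by
  show 0 < Complex.I.im
  simp

/-- `α(ρ) ≤ (5/16)(ρ + 2)` for `−2 < ρ ≤ 0` (`3ρ + 10 ≤ 10`), so `α(ρ) → 0` as `ρ ↓ −2`.
[cite: LawlerSchrammWerner2003Restriction, Thm. 8.4 (p. 37)] -/
theorem sleKappaRhoExponent_le_of_nonpos {ρ : ℝ} (hρ : -2 < ρ) (hρ0 : ρ ≤ 0) :
    sleKappaRhoExponent ρ ≤ 5 / 16 * (ρ + 2) := by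
  simp only [sleKappaRhoExponent]
  nlinarith

/-- **The comparison of SLE(8/3, ρ), `ρ < 0`, with SLE(8/3, 0) ([LSW] p. 38) from the one-sided
restriction martingale (Lemmas 8.9–8.10, i.e. Thm. 8.4) and the positivity of `P⁺_β{i ∈ K}`
for arbitrarily small `β > 0`.** Given `−2 < ρ < 0`, let `α = α(ρ) ∈ (0, 5/8)` and
`β' = 5/8 − α > 0`; choose `0 < β ≤ β'` and `P⁺_β` with `P⁺_β{i ∉ K} < 1` (`hpos`); all `P⁺`
exist by Thm. 8.4 (`exists_isRightRestrictionMeasure_of_martingale`), so `P⁺_{β'}{i ∉ K} < 1`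
(`measure_notMem_lt_one_mono`). With `P⁺_α`, `P⁺_{5/8}` the laws of `F^{ℝ₊}_ℍ(cl K_∞)` for the
two driving pairs (Thm. 8.4), `1/2 = P⁺_{5/8}{i ∉ K}` (the symmetry sentence, proved:
`SLEKappaRho.measure_I_notMem_fill_eq_half_holds`) `≤ P⁺_α{i ∉ K} · P⁺_{β'}{i ∉ K} < P⁺_α{i ∉ K}`.
[cite: LawlerSchrammWerner2003Restriction, proof of Cor. 8.6 (p. 38), first two sentences, with Thm. 8.4 (p. 37) and §8.2] -/
theorem SLEKappaRho.measure_I_notMem_fill_lt_of_neg_of_martingale_of_pos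
    (hM : SLEKappaRho.exists_isOneSidedMartingale)
    (hpos : ∀ ε : ℝ, 0 < ε → ∃ (β : ℝ) (Q : Measure RightConfig), 0 < β ∧ β ≤ ε ∧
      IsRightRestrictionMeasure β Q ∧ Q {K : RightConfig | Complex.I ∉ (K : Set ℂ)} < 1) :
    SLEKappaRho.measure_I_notMem_fill_lt_of_neg := by
  intro ρ O W O₀ W₀ hρ hρ0 hOW h0
  have h84 : SLEKappaRho.isRightRestrictionMeasure_fill :=
    SLEKappaRho.isRightRestrictionMeasure_fill_of_martingale hM
  have hex : exists_isRightRestrictionMeasure := exists_isRightRestrictionMeasure_of_martingale hM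
  have hI := I_mem_upperHalfPlaneSet
  set α : ℝ := sleKappaRhoExponent ρ with hα
  have hα58 : α < 5 / 8 := (sleKappaRhoExponent_lt_five_eighths_iff hρ).2 hρ0
  -- the small exponent `β ≤ β' = 5/8 − α` at which `P⁺_β` charges `i`, moved up to `β'`
  obtain ⟨β, Qβ, hβ, hββ', hQβ, hQβlt⟩ := hpos (5 / 8 - α) (by linarith)
  obtain ⟨Qβ', hQβ'⟩ := hex (5 / 8 - α) (by linarith)
  have hQβ'lt : Qβ' {K : RightConfig | Complex.I ∉ (K : Set ℂ)} < 1 :=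
    hQβ.measure_notMem_lt_one_mono hQβ' hββ' (fun h ↦ hex _ (by linarith)) hI hQβlt
  -- `P⁺_α` and `P⁺_{5/8}` as the laws of `K` for the two driving pairs (Thm. 8.4)
  obtain ⟨Kc, hKc, hae, hQ⟩ := h84 hρ hOW
  obtain ⟨Kc₀, hKc₀, hae₀, hQ₀⟩ := h84 (by norm_num : (-2 : ℝ) < 0) h0
  rw [sleKappaRhoExponent_zero] at hQ₀
  have h58 : IsRightRestrictionMeasure (α + (5 / 8 - α)) (preWienerMeasure.map Kc₀) := by
    rwa [add_sub_cancel]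
  rw [← SLEKappaRho.map_apply_setOf_I_notMem hKc hae, ← SLEKappaRho.map_apply_setOf_I_notMem hKc₀ hae₀]
  set a : ℝ≥0∞ := (preWienerMeasure.map Kc) {K : RightConfig | Complex.I ∉ (K : Set ℂ)} with ha
  set b : ℝ≥0∞ := Qβ' {K : RightConfig | Complex.I ∉ (K : Set ℂ)} with hb
  haveI := hQ.1
  have hhalf : (preWienerMeasure.map Kc₀) {K : RightConfig | Complex.I ∉ (K : Set ℂ)} = 1 / 2 := by
    rw [SLEKappaRho.map_apply_setOf_I_notMem hKc₀ hae₀]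
    exact SLEKappaRho.measure_I_notMem_fill_eq_half_holds h0
  have hle : (1 / 2 : ℝ≥0∞) ≤ a * b := hhalf ▸ hQ.measure_notMem_le_mul hQβ' h58 hI
  have ha0 : a ≠ 0 := by
    rintro ha0
    rw [ha0, zero_mul] at hle
    exact absurd hle (by norm_num)
  have hatop : a ≠ ⊤ := (prob_le_one.trans_lt ENNReal.one_lt_top).ne
  rw [hhalf]
  calc (1 / 2 : ℝ≥0∞) ≤ a * b := hle
    _ < a * 1 := ENNReal.mul_lt_mul_right ha0 hatop hQβ'lt
    _ = a := mul_one a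

/-- **The same with the positivity read on SLE(8/3, ρ) near `ρ = −2`** (through Thm. 8.4, the
law of `F^{ℝ₊}_ℍ(cl K_∞)` for SLE(8/3, ρ) is `P⁺_{α(ρ)}` and `α(ρ) ≤ (5/16)(ρ + 2)`): it
suffices that for every `ε > 0` some SLE(8/3, ρ) driving pair with `−2 < ρ ≤ −2 + ε`, `ρ ≤ 0`,
has `P{i ∈ F^{ℝ₊}_ℍ(cl K_∞(W))} ≠ 0`.
[cite: LawlerSchrammWerner2003Restriction, proof of Cor. 8.6 (p. 38), first two sentences, with Thm. 8.4 (p. 37) and §8.2] -/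
theorem SLEKappaRho.measure_I_notMem_fill_lt_of_neg_of_martingale_of_sle_pos
    (hM : SLEKappaRho.exists_isOneSidedMartingale)
    (hsle : ∀ ε : ℝ, 0 < ε → ∃ (ρ : ℝ) (O W : ℝ≥0 → (ℝ≥0 → ℝ) → ℝ), -2 < ρ ∧ ρ ≤ -2 + ε ∧ ρ ≤ 0 ∧
      IsSLEKappaRhoPair (8 / 3) ρ O W ∧
        preWienerMeasure {ω | Complex.I ∈ sleKappaRhoFill W ω} ≠ 0) :
    SLEKappaRho.measure_I_notMem_fill_lt_of_neg := by
  refine SLEKappaRho.measure_I_notMem_fill_lt_of_neg_of_martingale_of_pos hM fun ε hε ↦ ?_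
  have h84 : SLEKappaRho.isRightRestrictionMeasure_fill :=
    SLEKappaRho.isRightRestrictionMeasure_fill_of_martingale hM
  have hI := I_mem_upperHalfPlaneSet
  obtain ⟨ρ, O, W, hρ, hρε, hρ0, hOW, hne⟩ := hsle (16 / 5 * ε) (by positivity)
  obtain ⟨Kc, hKc, hae, hQ⟩ := h84 hρ hOW
  haveI := hQ.1
  refine ⟨sleKappaRhoExponent ρ, preWienerMeasure.map Kc, sleKappaRhoExponent_pos hρ, ?_, hQ, ?_⟩
  · calc sleKappaRhoExponent ρ ≤ 5 / 16 * (ρ + 2) := sleKappaRhoExponent_le_of_nonpos hρ hρ0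
      _ ≤ 5 / 16 * (16 / 5 * ε) := by gcongr; linarith
      _ = ε := by ring
  · -- `P⁺_{α(ρ)}{i ∉ K} = 1 − P⁺_{α(ρ)}{i ∈ K} = 1 − P{i ∈ F(cl K_∞)} < 1`
    haveI : IsProbabilityMeasure preWienerMeasure := isProbabilityMeasure_preWienerMeasure'
    have hcompl : {K : RightConfig | Complex.I ∉ (K : Set ℂ)} =
        {K : RightConfig | Complex.I ∈ (K : Set ℂ)}ᶜ := by
      ext K
      simp
    have hmem : MeasurableSet {K : RightConfig | Complex.I ∈ (K : Set ℂ)} := by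
      have h := (RightConfig.measurableSet_notMem hI).compl
      rwa [hcompl, compl_compl] at h
    have hne' : (preWienerMeasure.map Kc) {K : RightConfig | Complex.I ∈ (K : Set ℂ)} ≠ 0 := by
      rw [Measure.map_apply hKc hmem]
      have heq : preWienerMeasure (Kc ⁻¹' {K : RightConfig | Complex.I ∈ (K : Set ℂ)}) =
          preWienerMeasure {ω | Complex.I ∈ sleKappaRhoFill W ω} := by
        refine measure_congr (hae.mono fun ω hω ↦ ?_)
        show (Complex.I ∈ (Kc ω : Set ℂ)) = (Complex.I ∈ sleKappaRhoFill W ω)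
        rw [hω]
      rwa [heq]
    rw [hcompl, prob_compl_eq_one_sub hmem]
    exact ENNReal.sub_lt_self ENNReal.one_ne_top one_ne_zero hne'

/-! ### The named fact, and [LSW] p. 5 result 2, from four leaves and the small-`β` positivity -/

/-- **[LSW] Cor. 8.6 ("for all `α < 5/8`, `P_α` does not exist") from the martingale leaf and the
small-`β` positivity**, through `not_exists_isRestrictionMeasure_of_lt_five_eighths_of_two_leaves`
(`RestrictionMeasuresFiveEighthsProofs`).
[cite: LawlerSchrammWerner2003Restriction, Cor. 8.6 (p. 37) and its proof (p. 38), with §8.2] -/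
theorem not_exists_isRestrictionMeasure_of_lt_five_eighths_of_martingale_of_pos
    (hM : SLEKappaRho.exists_isOneSidedMartingale)
    (hpos : ∀ ε : ℝ, 0 < ε → ∃ (β : ℝ) (Q : Measure RightConfig), 0 < β ∧ β ≤ ε ∧
      IsRightRestrictionMeasure β Q ∧ Q {K : RightConfig | Complex.I ∉ (K : Set ℂ)} < 1) :
    not_exists_isRestrictionMeasure_of_lt_five_eighths :=
  not_exists_isRestrictionMeasure_of_lt_five_eighths_of_two_leaves hM
    (SLEKappaRho.measure_I_notMem_fill_lt_of_neg_of_martingale_of_pos hM hpos)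

/-- **[LSW] p. 5 result 2, first sentence (outer reading), from FOUR leaves and the small-`β`
positivity**: the one-sided restriction martingale of Lemmas 8.9–8.10 (`hM`), "`P⁺_β{i ∈ K} > 0`
for arbitrarily small `β`" in place of the comparison sentence of p. 38
(`SLEKappaRho.measure_I_notMem_fill_lt_of_neg_of_martingale_of_pos`), and the three §7 leaves of
`IsRestrictionMeasure.eq_five_eighths_of_outer_simple_of_five_leaves` (bubble measure with
interior points, `Ξ(κ) ∈ Ω` a.s., Thm. 6.5).
[cite: LawlerSchrammWerner2003Restriction, p. 5 result 2; Thm. 7.3 (p. 29), Thm. 8.4 (p. 37), Cor. 8.6 (pp. 37–38), §8.2] -/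
theorem IsRestrictionMeasure.eq_five_eighths_of_outer_simple_of_four_leaves_of_pos
    (hM : SLEKappaRho.exists_isOneSidedMartingale)
    (hpos : ∀ ε : ℝ, 0 < ε → ∃ (β : ℝ) (Q : Measure RightConfig), 0 < β ∧ β ≤ ε ∧
      IsRightRestrictionMeasure β Q ∧ Q {K : RightConfig | Complex.I ∉ (K : Set ℂ)} < 1)
    (hμex : exists_isBrownianBubbleMeasure_ae_interior_nonempty)
    (hcfg : SLEBubbles.ae_mem_restrictionConfigs)
    (h65 : SLEBubbles.lintegral_poissonAvoidance_eq_rpow) :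
    IsRestrictionMeasure.eq_five_eighths_of_outer_simple :=
  IsRestrictionMeasure.eq_five_eighths_of_outer_simple_of_five_leaves hM
    (SLEKappaRho.measure_I_notMem_fill_lt_of_neg_of_martingale_of_pos hM hpos) hμex hcfg h65

/-- **[LSW] p. 5 result 2 (`LawlerSchrammWerner2003`: a conformally covariant chordal family
with two-sided restriction carried by simple curves is chordal SLE_{8/3}) from the same four
leaves and the small-`β` positivity**, through `LawlerSchrammWerner2003_of_five_eighths`.
[cite: LawlerSchrammWerner2003Restriction, p. 5 result 2; Prop. 3.3, Thm. 6.1, Thm. 7.3, Cor. 8.6, §8.2] -/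
theorem LawlerSchrammWerner2003_of_four_leaves_of_pos
    (hM : SLEKappaRho.exists_isOneSidedMartingale)
    (hpos : ∀ ε : ℝ, 0 < ε → ∃ (β : ℝ) (Q : Measure RightConfig), 0 < β ∧ β ≤ ε ∧
      IsRightRestrictionMeasure β Q ∧ Q {K : RightConfig | Complex.I ∉ (K : Set ℂ)} < 1)
    (hμex : exists_isBrownianBubbleMeasure_ae_interior_nonempty)
    (hcfg : SLEBubbles.ae_mem_restrictionConfigs)
    (h65 : SLEBubbles.lintegral_poissonAvoidance_eq_rpow) : LawlerSchrammWerner2003 :=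
  LawlerSchrammWerner2003_of_five_eighths
    (IsRestrictionMeasure.eq_five_eighths_of_outer_simple_of_four_leaves_of_pos hM hpos hμex hcfg h65)

end Literature.Probability.RandomPlanarGeometry

end
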